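import Literature.MathematicalPhysics.QuantumLattice.GibbsVariationalPrinciple
import HarnessLib

/-!
# The slack of a free-energy chord with a ZERO-ENTROPY cold input (the typed limit of the chord route)

Topic `Literature/MathematicalPhysics/QuantumLattice` (thermal toolkit). The convexity chord
`Re⟨H⟩_β ≤ (log Z_{β_h} − log Z_β)/(β − β_h)` (`Matrix.IsHermitian.energy_le_chord`, Israel 1979 Lemma II.3.1 /
Ruelle 1969 §2.5) becomes a CERTIFIED energy ceiling once `log Z_{β_h} ≤ u_h` (a pressure ceiling at the hot
anchor) and `ℓ ≤ log Z_β` (a free-energy ceiling at the target) are supplied. When the only available `ℓ` is the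
ZERO-ENTROPY one, `ℓ = −β E₀⁺` with `E₀ ≤ E₀⁺` (a variational ground-energy bound: `log Z_β ≥ −β E₀`,
Gustafson–Sigal Thm 18.10), the chord cannot be sharp: its slack is at least the gap between the true pressure
and its zero-entropy floor, `log Z_β + β E₀ = S_β − β (E_β − E₀) ≥ 0`, divided by `β − β_h`:

* `Matrix.IsHermitian.log_partitionFn_add_mul_groundEnergy_eq` / `…_nonneg`: the gap identity and its sign;
* `Matrix.IsHermitian.energy_add_gap_div_le_zeroEntropy_chord`: for `0 < β_h < β`, `log Z_{β_h} ≤ u_h`, `E₀ ≤ E₀⁺`: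
  `E_β + (S_β − β(E_β − E₀))/(β − β_h) ≤ (u_h + β E₀⁺)/(β − β_h)`;
* `Matrix.IsHermitian.energy_add_entropy_div_sub_le_zeroEntropy_chord`: hence (as `0 ≤ β_h`)
  `E_β + (S_β/β − (E_β − E₀)) ≤ (u_h + β E₀⁺)/(β − β_h)` — EVERY such chord overshoots the energy by at least
  `T·S_β − (E_β − E₀)`, whatever the hot anchor and however sharp `u_h` is.

Per site in the thermodynamic limit this is the «typed limit» of the free-energy route at low temperature recorded by
the hubbard-thermal programme (slack ≥ `T s(T) − (e(T) − e₀)`, ≈ 0.05–0.1·t at `U = 8t`, `n = 7/8`, `T = t/4` [float]):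
only a cold input carrying entropy (a certified `ℓ > −β E₀`) or a direct energy functional can beat it.
[cite: Israel1979, Lemma II.3.1] [cite: GustafsonSigal2003, §18.3 Theorem 18.10]. Everything is PROVED; no named fact.
-/

noncomputable section

open scoped Matrix.Norms.L2Operator ComplexOrder
open Finset Literature.InformationTheory.Entropy Literature.MathematicalPhysics.QuantumLattice

namespace Matrix

variable {n : Type*} [Fintype n] [DecidableEq n] [Nonempty n] {H : Matrix n n ℂ}

omit [Nonempty n] in
/-- **The zero-entropy gap identity**: `log Z_β + β E₀ = S_β − β (E_β − E₀)` (`S_β = log Z_β + β E_β` is the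
entropy of the Gibbs state). [cite: Israel1979, Lemma II.3.1] -/
theorem IsHermitian.log_partitionFn_add_mul_groundEnergy_eq (_hH : H.IsHermitian) (β : ℝ) :
    Real.log (partitionFn β H).re + β * H.groundEnergy =
      gibbsEntropy β H - β * ((gibbsState β H H).re - H.groundEnergy) := by
  rw [gibbsEntropy_def]
  ring

/-- **The zero-entropy gap is nonnegative**: `0 ≤ log Z_β + β E₀` (every real `β`; `Z_β ≥ e^{−β E₀}`), i.e.
`β (E_β − E₀) ≤ S_β`. [cite: GustafsonSigal2003, §18.3 Theorem 18.10] -/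
theorem IsHermitian.log_partitionFn_add_mul_groundEnergy_nonneg (hH : H.IsHermitian) (β : ℝ) :
    0 ≤ Real.log (partitionFn β H).re + β * H.groundEnergy := by
  have h := hH.neg_log_partitionFn_le_mul_groundEnergy β
  linarith

/-- **Slack of the zero-entropy chord** (`0 < β_h < β`): for ANY pressure ceiling `log Z_{β_h} ≤ u_h` at the hot
anchor and ANY variational ground-energy bound `E₀ ≤ E₀⁺` used as the cold input `ℓ = −β E₀⁺`, the chord ceiling
`(u_h + β E₀⁺)/(β − β_h)` exceeds the true energy by at least the zero-entropy gap over `β − β_h`: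
`E_β + (S_β − β(E_β − E₀))/(β − β_h) ≤ (u_h + β E₀⁺)/(β − β_h)`. Proof: the supporting line of the convex
`β ↦ log Z_β` at `β` gives `log Z_{β_h} ≥ log Z_β + (β − β_h) E_β`. [cite: Israel1979, Lemma II.3.1] -/
theorem IsHermitian.energy_add_gap_div_le_zeroEntropy_chord (hH : H.IsHermitian) {β βh : ℝ} (hβ : 0 < β)
    (hlt : βh < β) {uh E₀' : ℝ} (huh : Real.log (partitionFn βh H).re ≤ uh) (hE : H.groundEnergy ≤ E₀') :
    (gibbsState β H H).re + (gibbsEntropy β H - β * ((gibbsState β H H).re - H.groundEnergy)) / (β - βh) ≤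
      (uh + β * E₀') / (β - βh) := by
  have hgap : Real.log (partitionFn βh H).re + β * H.groundEnergy ≥
      Real.log (partitionFn β H).re + (β - βh) * (gibbsState β H H).re + β * H.groundEnergy := by
    have h := log_partitionFn_sub_mul_energy_le hH βh hβ
    linarith
  have hpos : 0 < β - βh := sub_pos.mpr hlt
  have hβE : β * H.groundEnergy ≤ β * E₀' := mul_le_mul_of_nonneg_left hE hβ.le
  rw [← hH.log_partitionFn_add_mul_groundEnergy_eq β]
  have key : (gibbsState β H H).re * (β - βh) + (Real.log (partitionFn β H).re + β * H.groundEnergy) ≤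
      uh + β * E₀' := by nlinarith
  have hdiv := div_le_div_of_nonneg_right key hpos.le
  rwa [add_div, mul_div_cancel_right₀ _ hpos.ne'] at hdiv

/-- **Every zero-entropy chord overshoots by at least `T·S_β − (E_β − E₀)`** (`0 ≤ β_h < β`): with `u_h`, `E₀⁺` as
above, `E_β + (S_β/β − (E_β − E₀)) ≤ (u_h + β E₀⁺)/(β − β_h)` — independent of the hot anchor and of how sharp
`u_h` is; the missing cold-side entropy is amplified by `β/(β − β_h) ≥ 1`. This is the typed LIMIT of the
free-energy (chord) route with a pure-state cold input. [cite: Israel1979, Lemma II.3.1] -/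
theorem IsHermitian.energy_add_entropy_div_sub_le_zeroEntropy_chord (hH : H.IsHermitian) {β βh : ℝ}
    (hβh : 0 ≤ βh) (hlt : βh < β) {uh E₀' : ℝ} (huh : Real.log (partitionFn βh H).re ≤ uh)
    (hE : H.groundEnergy ≤ E₀') :
    (gibbsState β H H).re + (gibbsEntropy β H / β - ((gibbsState β H H).re - H.groundEnergy)) ≤
      (uh + β * E₀') / (β - βh) := by
  have hβ : 0 < β := lt_of_le_of_lt hβh hlt
  have h1 := hH.energy_add_gap_div_le_zeroEntropy_chord hβ hlt huh hE
  have hgap0 : 0 ≤ gibbsEntropy β H - β * ((gibbsState β H H).re - H.groundEnergy) := by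
    rw [← hH.log_partitionFn_add_mul_groundEnergy_eq β]
    exact hH.log_partitionFn_add_mul_groundEnergy_nonneg β
  -- `x/β ≤ x/(β − β_h)` for `x ≥ 0`, `0 < β − β_h ≤ β`
  have hmono : (gibbsEntropy β H - β * ((gibbsState β H H).re - H.groundEnergy)) / β ≤
      (gibbsEntropy β H - β * ((gibbsState β H H).re - H.groundEnergy)) / (β - βh) :=
    div_le_div_of_nonneg_left hgap0 (sub_pos.mpr hlt) (by linarith)
  have hid : gibbsEntropy β H / β - ((gibbsState β H H).re - H.groundEnergy) =
      (gibbsEntropy β H - β * ((gibbsState β H H).re - H.groundEnergy)) / β := by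
    field_simp
  rw [hid]
  linarith

/-- **Lower bound on the slack in certificate vocabulary**: if the chord with the zero-entropy cold input certifies
`E_β ≤ e⁺ := (u_h + β E₀⁺)/(β − β_h)`, then `e⁺ − E_β ≥ S_β/β − (E_β − E₀) ≥ −(E_β − E₀)`; in particular a chord
ceiling within `δ` of the truth forces `S_β ≤ β (δ + (E_β − E₀))` — at `T·S_β > δ + (E_β − E₀)` no hot anchor
can deliver a `δ`-sharp ceiling. [cite: Israel1979, Lemma II.3.1] -/
theorem IsHermitian.gibbsEntropy_le_of_zeroEntropy_chord_sharp (hH : H.IsHermitian) {β βh : ℝ}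
    (hβh : 0 ≤ βh) (hlt : βh < β) {uh E₀' δ : ℝ} (huh : Real.log (partitionFn βh H).re ≤ uh)
    (hE : H.groundEnergy ≤ E₀') (hsharp : (uh + β * E₀') / (β - βh) ≤ (gibbsState β H H).re + δ) :
    gibbsEntropy β H ≤ β * (δ + ((gibbsState β H H).re - H.groundEnergy)) := by
  have hβ : 0 < β := lt_of_le_of_lt hβh hlt
  have h := hH.energy_add_entropy_div_sub_le_zeroEntropy_chord hβh hlt huh hE
  have h2 : gibbsEntropy β H / β ≤ δ + ((gibbsState β H H).re - H.groundEnergy) := by linarith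
  rwa [div_le_iff₀ hβ, mul_comm] at h2

end Matrix

end
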